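import Literature.Computability.QuantumComplexity.ObliviousAmplification
import Literature.Computability.QuantumComplexity.CliffordTInverse
import HarnessLib

/-!
# The oblivious-amplitude-amplification word as a Clifford+T circuit

Topic `Literature/Computability/QuantumComplexity`; a step in the discharge of
`ajl_jonesApproxProblem_mem_PromiseBQP`. Given a circuit `GW` (matrix `W`) and a circuit `GR` acting
as the reflection `1 − 2·projOn P₀` on states supported on a set `S` of "helper-clean" labels
(`ReflectionGadget.reflectCircuit_mulVec_eq`), the word

  `oaaWordCircuit GW GR = GW ++ GR ++ GW.inv ++ GR ++ GW`

acts on every state supported on `S` as `−oaaOp (projOn P₀) W Wᴴ` (`oaaWordCircuit_mulVec`; the sign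
because `1 − 2Π = −(2Π − 1)` enters twice and `oaaOp` carries one more), provided `W` and `W.inv`
preserve `S`-support — which holds as soon as no gate of `GW` touches the helper wires
(`preservesSupp_toMatrix_of_offWires`, `preservesSupp_inv_toMatrix_of_offWires`). Consequently an
`ImplOn P₀ (oaaOp Π W Wᴴ) V δ` (from `SandwichApprox.implOn_oaaOp_of_entries`) yields
`ImplOn (P₀ ∩ S) (word matrix) (−V) δ` (`implOn_oaaWordCircuit`).

## References

* D. W. Berry, A. M. Childs, R. Cleve, R. Kothari, R. D. Somma, STOC 2014, Lemma 3.1 and proof of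
  Thm. 1.1 [BerryEtAl2014].
* M. A. Nielsen, I. L. Chuang, *Quantum Computation and Quantum Information*, CUP 2010, §6.1.2
  [NielsenChuang2010].
-/

noncomputable section

namespace Literature.Computability.QuantumComplexity

open _root_.Matrix Cryptography

variable {N : ℕ}

/-! ### Circuits not touching a list of wires preserve cleanliness of those wires -/

/-- The labels clean on the wires `as`. [folklore] -/
def cleanOn (as : List (Fin N)) : Set (QReg N) := {y | ∀ a ∈ as, y a = false}

/-- Membership in `cleanOn as`. [folklore] -/
@[simp] theorem mem_cleanOn {as : List (Fin N)} {y : QReg N} : y ∈ cleanOn as ↔ ∀ a ∈ as, y a = false := Iff.rfl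

/-- A gate avoiding the wires `as` preserves `cleanOn as`-support. [folklore] -/
theorem preservesSupp_gate_toMatrix_of_offWires (A : Language Bool) {as : List (Fin N)} (g : QGate cliffordT N)
    (hg : ∀ a ∈ as, a ∉ g.wires) : PreservesSupp (cleanOn as) (g.toMatrix A) := by
  have key : ∀ {k : ℕ} (e : Fin k ↪ Fin N), (∀ a ∈ as, a ∉ Set.range e) → ∀ (M : Matrix (QReg k) (QReg k) ℂ),
      PreservesSupp (cleanOn as) (placeGate e M) := by
    intro k e he M
    refine preservesSupp_placeGate_of_offWires e (fun x y hxy => ?_) M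
    simp only [mem_cleanOn]
    exact forall₂_congr fun a ha => by rw [hxy a (he a ha)]
  cases g with
  | gate g e =>
    exact key e (fun a ha hr => hg a ha (by obtain ⟨i, rfl⟩ := hr; simp [QGate.wires])) _
  | oracle k e =>
    exact key e (fun a ha hr => hg a ha (by obtain ⟨i, rfl⟩ := hr; simp [QGate.wires])) _

/-- **A circuit avoiding the wires `as` preserves `cleanOn as`-support.** [folklore] -/
theorem preservesSupp_toMatrix_of_offWires (A : Language Bool) {as : List (Fin N)} :
    ∀ (gs : List (QGate cliffordT N)), (∀ g ∈ gs, ∀ a ∈ as, a ∉ g.wires) →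
      PreservesSupp (cleanOn as) ((⟨gs⟩ : QCircuit cliffordT N).toMatrix A)
  | [], _ => fun ψ hψ => by simpa using hψ
  | g :: gs, h => by
    rw [QCircuit.toMatrix_cons]
    exact (preservesSupp_toMatrix_of_offWires A gs fun g' hg' => h g' (by simp [hg'])).mul
      (preservesSupp_gate_toMatrix_of_offWires A g (h g (by simp)))

/-- The inverse of a circuit avoiding `as` preserves `cleanOn as`-support. [folklore] -/
theorem preservesSupp_inv_toMatrix_of_offWires (A : Language Bool) {as : List (Fin N)} (C : QCircuit cliffordT N)
    (h : ∀ g ∈ C.gates, ∀ a ∈ as, a ∉ g.wires) : PreservesSupp (cleanOn as) (C.inv.toMatrix A) := by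
  have := preservesSupp_toMatrix_of_offWires A C.inv.gates fun g hg => h g (QCircuit.mem_gates_of_mem_inv hg)
  exact this

/-! ### The word -/

/-- **The OAA word** `W R W⁻¹ R W` as a circuit. [cite: BerryEtAl2014, Lemma 3.1 and proof of Thm. 1.1] -/
def oaaWordCircuit (GW GR : QCircuit cliffordT N) : QCircuit cliffordT N :=
  (((GW.append GR).append GW.inv).append GR).append GW

/-- The word is oracle-free when its letters are. [folklore] -/
theorem oaaWordCircuit_isOracleFree {GW GR : QCircuit cliffordT N} (hW : GW.IsOracleFree) (hR : GR.IsOracleFree) :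
    (oaaWordCircuit GW GR).IsOracleFree := by
  intro g hg
  simp only [oaaWordCircuit, QCircuit.append, List.mem_append] at hg
  rcases hg with (((hg | hg) | hg) | hg) | hg
  · exact hW g hg
  · exact hR g hg
  · exact QCircuit.inv_isOracleFree hW g hg
  · exact hR g hg
  · exact hW g hg

/-- A diagonal-like operator `1 − 2Π` preserves every support. [folklore] -/
theorem suppIn_one_sub_two_smul_projOn_mulVec (P₀ S : Set (QReg N)) {ψ : QReg N → ℂ} (hψ : SuppIn S ψ) :
    SuppIn S ((1 - (2 : ℂ) • projOn P₀) *ᵥ ψ) := by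
  classical
  intro y hy
  rw [Matrix.sub_mulVec, Matrix.one_mulVec, Pi.sub_apply, Matrix.smul_mulVec, Pi.smul_apply, projOn_mulVec_apply,
    hψ y hy]
  simp [Set.indicator_apply, hψ y hy]

/-- **The word acts as `−oaaOp Π W Wᴴ` on helper-clean states.** [cite: BerryEtAl2014, Lemma 3.1 and proof of Thm. 1.1] -/
theorem oaaWordCircuit_mulVec (GW GR : QCircuit cliffordT N) (P₀ S : Set (QReg N))
    (hR : ∀ ψ, SuppIn S ψ → GR.toMatrix 0 *ᵥ ψ = (1 - (2 : ℂ) • projOn P₀) *ᵥ ψ)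
    (hWS : PreservesSupp S (GW.toMatrix 0)) (hWS' : PreservesSupp S (GW.inv.toMatrix 0))
    (ψ : QReg N → ℂ) (hψ : SuppIn S ψ) :
    (oaaWordCircuit GW GR).toMatrix 0 *ᵥ ψ = (-oaaOp (projOn P₀) (GW.toMatrix 0) (GW.toMatrix 0)ᴴ) *ᵥ ψ := by
  set W := GW.toMatrix 0 with hW
  have hinv : GW.inv.toMatrix 0 = Wᴴ := by rw [QCircuit.inv_toMatrix_eq_star]; rfl
  rw [oaaWordCircuit, QCircuit.toMatrix_append, QCircuit.toMatrix_append, QCircuit.toMatrix_append, QCircuit.toMatrix_append,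
    ← hW]
  -- push `ψ` through the five letters
  have h1 : SuppIn S (W *ᵥ ψ) := hWS ψ hψ
  have h2 : SuppIn S ((1 - (2 : ℂ) • projOn P₀) *ᵥ (W *ᵥ ψ)) := suppIn_one_sub_two_smul_projOn_mulVec P₀ S h1
  have h3 : SuppIn S (Wᴴ *ᵥ ((1 - (2 : ℂ) • projOn P₀) *ᵥ (W *ᵥ ψ))) := by rw [← hinv]; exact hWS' _ h2
  rw [← Matrix.mulVec_mulVec, ← Matrix.mulVec_mulVec, ← Matrix.mulVec_mulVec, ← Matrix.mulVec_mulVec, hR _ h1, hinv,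
    hR _ h3]
  rw [oaaOp, oaaReflect, neg_neg]
  simp only [← Matrix.mulVec_mulVec]
  -- `1 − 2Π = −(2Π − 1)` twice
  have e : (1 - (2 : ℂ) • projOn P₀) = -((2 : ℕ) • projOn P₀ - 1) := by rw [neg_sub, ← Nat.cast_smul_eq_nsmul ℂ]; norm_num
  rw [e, Matrix.neg_mulVec, Matrix.mulVec_neg, Matrix.neg_mulVec, Matrix.mulVec_neg, Matrix.mulVec_neg, Matrix.mulVec_neg, neg_neg]

/-- Negating both the operator and the target keeps an implementation. [folklore] -/
theorem ImplOn.neg {P : Set (QReg N)} {M U : Matrix (QReg N) (QReg N) ℂ} {δ : ℝ} (h : ImplOn P M U δ) :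
    ImplOn P (-M) (-U) δ := by
  intro ψ hψ
  have := h ψ hψ
  rw [Matrix.neg_mulVec, Matrix.neg_mulVec, show -(M *ᵥ ψ) - -(U *ᵥ ψ) = -(M *ᵥ ψ - U *ᵥ ψ) by abel, l2Norm_neg]
  exact this

/-- **The word implements `−V` wherever `oaaOp` implements `V`, on helper-clean inputs.**
[cite: BerryEtAl2014, Lemma 3.1 and proof of Thm. 1.1] -/
theorem implOn_oaaWordCircuit (GW GR : QCircuit cliffordT N) (P₀ S : Set (QReg N))
    (hR : ∀ ψ, SuppIn S ψ → GR.toMatrix 0 *ᵥ ψ = (1 - (2 : ℂ) • projOn P₀) *ᵥ ψ)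
    (hWS : PreservesSupp S (GW.toMatrix 0)) (hWS' : PreservesSupp S (GW.inv.toMatrix 0))
    {V : Matrix (QReg N) (QReg N) ℂ} {δ : ℝ} (h : ImplOn P₀ (oaaOp (projOn P₀) (GW.toMatrix 0) (GW.toMatrix 0)ᴴ) V δ) :
    ImplOn (P₀ ∩ S) ((oaaWordCircuit GW GR).toMatrix 0) (-V) δ := by
  intro ψ hψ
  have hS : SuppIn S ψ := fun y hy => hψ y fun hh => hy hh.2
  have hP : SuppIn P₀ ψ := fun y hy => hψ y fun hh => hy hh.1
  rw [oaaWordCircuit_mulVec GW GR P₀ S hR hWS hWS' ψ hS]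
  exact h.neg ψ hP

end Literature.Computability.QuantumComplexity

end
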